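import Mathlib
import HarnessLib
import Summits.HubbardSuperconductivity.HubbardSuperconductivity.Theorems.BalabanIRBirComplexStableXYFixedVolumeLaplace

/-!
# BalabanIR engine `BirComplexStableXY` (stmt-HubbardSuperconductivity-2080): second-order
expansion of window actions and local-to-global coercivity

Support lemmas for crux 2 of route BalabanIR (`--supports stmt-HubbardSuperconductivity-2080`),
companion of `BalabanIRBirComplexStableXYFixedVolumeLaplace.lean` (abstract toolkit, no
definitions).  The two analytic hypotheses of the multidimensional Laplace lemma
`birLaplace_tendsto` are produced here for phases of the form

  `f δ = Σ_k w_k · exp (i X_k δ)`,  `X_k δ = Σ_j a_{kj} δ_j` real linear forms,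

* `birExp_norm_taylor_two_le`: `‖e^{ix} − 1 − ix + x²/2‖ ≤ |x|³/6` (two integrations of
  `‖e^{ix} − 1‖ ≤ |x|`);
* `birExpand_norm_sub_quad_le`: if `Σ_k w_k = 0` and `Σ_k w_k X_k ≡ 0` (in the application:
  hypotheses (N) and (U1) of the item) then `‖f δ − q δ‖ ≤ C (Σ_j δ_j²) ‖δ‖` with the quadratic
  germ `q δ = −½ Σ_k w_k (X_k δ)²`, which is the matrix form `½ Σ_{ij} Q_{ij} δ_i δ_j`
  (`birExpand_quad_eq_matrix`, `Q` symmetric);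
* `birCoercive_of_local`: a continuous non-negative function on the closed cube `[-π, π]^J`
  vanishing only at `0` and bounded below by `λ Σ δ_j²` near `0` is bounded below by `m Σ δ_j²`
  on the whole cube (compactness); `birCoercive_quadratic`: a continuous `2`-homogeneous function
  positive off `0` dominates `λ Σ δ_j²`; `birCoercive_one_sub_cos`: `2y²/π² ≤ 1 − cos y` on
  `|y| ≤ π`.
-/

namespace Summit.HubbardSuperconductivity.HubbardSuperconductivity.Theorems

open scoped BigOperators ComplexConjugate
open MeasureTheory Set Complex

section TaylorExp

/-- Derivative of `y ↦ exp (i y)` along the real line. -/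
theorem birExp_hasDerivAt (t : ℝ) :
    HasDerivAt (fun y : ℝ => cexp (I * y)) (I * cexp (I * t)) t := by
  have hI : HasDerivAt (fun y : ℝ => I * (y : ℂ)) (I * 1) t :=
    (hasDerivAt_id t).ofReal_comp.const_mul I
  have h := hI.cexp
  simpa [mul_comm] using h

/-- First integration: `‖e^{ix} − 1 − ix‖ ≤ x²/2` for `x ≥ 0`. -/
theorem birExp_norm_taylor_one_le_of_nonneg {x : ℝ} (hx : 0 ≤ x) :
    ‖cexp (I * x) - 1 - I * x‖ ≤ x ^ 2 / 2 := by
  have hderiv : ∀ t : ℝ, HasDerivAt (fun y : ℝ => cexp (I * y) - 1 - I * y)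
      (I * (cexp (I * t) - 1)) t := by
    intro t
    have hI : HasDerivAt (fun y : ℝ => I * (y : ℂ)) (I * 1) t :=
      (hasDerivAt_id t).ofReal_comp.const_mul I
    have h := ((birExp_hasDerivAt t).sub_const 1).sub hI
    refine h.congr_deriv ?_
    ring
  have hcont : Continuous fun t : ℝ => I * (cexp (I * t) - 1) := by fun_prop
  have hftc := intervalIntegral.integral_eq_sub_of_hasDerivAt (a := 0) (b := x)
    (fun t _ => hderiv t) (hcont.intervalIntegrable _ _)
  simp only [ofReal_zero, mul_zero, Complex.exp_zero, sub_self, sub_zero] at hftc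
  rw [← hftc]
  calc ‖∫ t in (0:ℝ)..x, I * (cexp (I * t) - 1)‖
      ≤ ∫ t in (0:ℝ)..x, ‖I * (cexp (I * t) - 1)‖ :=
        intervalIntegral.norm_integral_le_integral_norm hx
    _ ≤ ∫ t in (0:ℝ)..x, t := by
        refine intervalIntegral.integral_mono_on hx ?_ ?_ fun t ht => ?_
        · exact (hcont.norm).intervalIntegrable _ _
        · exact continuous_id.intervalIntegrable _ _
        · rw [norm_mul, Complex.norm_I, one_mul]
          have := Real.norm_exp_I_mul_ofReal_sub_one_le (x := t)
          rw [Real.norm_eq_abs, abs_of_nonneg ht.1] at this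
          exact this
    _ = x ^ 2 / 2 := by rw [integral_id]; ring

/-- Second integration: `‖e^{ix} − 1 − ix + x²/2‖ ≤ x³/6` for `x ≥ 0`. -/
theorem birExp_norm_taylor_two_le_of_nonneg {x : ℝ} (hx : 0 ≤ x) :
    ‖cexp (I * x) - 1 - I * x + (x : ℂ) ^ 2 / 2‖ ≤ x ^ 3 / 6 := by
  have hderiv : ∀ t : ℝ, HasDerivAt (fun y : ℝ => cexp (I * y) - 1 - I * y + (y : ℂ) ^ 2 / 2)
      (I * (cexp (I * t) - 1 - I * t)) t := by
    intro t
    have hI : HasDerivAt (fun y : ℝ => I * (y : ℂ)) (I * 1) t :=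
      (hasDerivAt_id t).ofReal_comp.const_mul I
    have hsq : HasDerivAt (fun y : ℝ => (y : ℂ) ^ 2 / 2) ((2 : ℕ) * (t : ℂ) ^ (2 - 1) * 1 / 2) t :=
      ((hasDerivAt_id t).ofReal_comp.pow 2).div_const 2
    have h := (((birExp_hasDerivAt t).sub_const 1).sub hI).add hsq
    refine h.congr_deriv ?_
    rw [show (2 - 1 : ℕ) = 1 from rfl, pow_one]
    push_cast
    linear_combination (t : ℂ) * Complex.I_sq
  have hcont : Continuous fun t : ℝ => I * (cexp (I * t) - 1 - I * t) := by fun_prop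
  have hftc := intervalIntegral.integral_eq_sub_of_hasDerivAt (a := 0) (b := x)
    (fun t _ => hderiv t) (hcont.intervalIntegrable _ _)
  simp only [ofReal_zero, mul_zero, Complex.exp_zero, sub_self, sub_zero, ne_eq,
    OfNat.ofNat_ne_zero, not_false_eq_true, zero_pow, zero_div, add_zero] at hftc
  rw [← hftc]
  calc ‖∫ t in (0:ℝ)..x, I * (cexp (I * t) - 1 - I * t)‖
      ≤ ∫ t in (0:ℝ)..x, ‖I * (cexp (I * t) - 1 - I * t)‖ :=
        intervalIntegral.norm_integral_le_integral_norm hx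
    _ ≤ ∫ t in (0:ℝ)..x, t ^ 2 / 2 := by
        refine intervalIntegral.integral_mono_on hx ?_ ?_ fun t ht => ?_
        · exact (hcont.norm).intervalIntegrable _ _
        · exact (continuous_id.pow 2 |>.div_const 2).intervalIntegrable _ _
        · rw [norm_mul, Complex.norm_I, one_mul]
          exact birExp_norm_taylor_one_le_of_nonneg ht.1
    _ = x ^ 3 / 6 := by
        rw [intervalIntegral.integral_div, integral_pow]; ring

/-- `‖e^{ix} − 1 − ix + x²/2‖ ≤ |x|³/6` for every real `x`. -/
theorem birExp_norm_taylor_two_le (x : ℝ) :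
    ‖cexp (I * x) - 1 - I * x + (x : ℂ) ^ 2 / 2‖ ≤ |x| ^ 3 / 6 := by
  rcases le_or_gt 0 x with hx | hx
  · rw [abs_of_nonneg hx]; exact birExp_norm_taylor_two_le_of_nonneg hx
  · have hneg : 0 ≤ -x := by linarith
    have h := birExp_norm_taylor_two_le_of_nonneg hneg
    have e0 : conj (I * ((-x : ℝ) : ℂ)) = I * (x : ℂ) := by
      rw [map_mul, Complex.conj_I, Complex.conj_ofReal]; push_cast; ring
    have e1 : conj (cexp (I * ((-x : ℝ) : ℂ))) = cexp (I * x) := by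
      rw [← Complex.exp_conj, e0]
    have e3 : conj (((-x : ℝ) : ℂ) ^ 2 / 2) = (x : ℂ) ^ 2 / 2 := by
      rw [map_div₀, map_pow, Complex.conj_ofReal, map_ofNat]; push_cast; ring
    have hconj : conj (cexp (I * ((-x : ℝ) : ℂ)) - 1 - I * ((-x : ℝ) : ℂ) + ((-x : ℝ) : ℂ) ^ 2 / 2)
        = cexp (I * x) - 1 - I * x + (x : ℂ) ^ 2 / 2 := by
      rw [map_add, map_sub, map_sub, map_one, e1, e0, e3]
    rw [← hconj, Complex.norm_conj, abs_of_neg hx]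
    exact h

end TaylorExp

section Expand

variable {κ J : Type*} [Fintype κ] [Fintype J]

/-- A real linear form is bounded by its `ℓ¹` coefficient norm times the sup norm. -/
theorem birExpand_abs_form_le (a : J → ℝ) (δ : J → ℝ) :
    |∑ j, a j * δ j| ≤ (∑ j, |a j|) * ‖δ‖ := by
  calc |∑ j, a j * δ j| ≤ ∑ j, |a j * δ j| := Finset.abs_sum_le_sum_abs _ _
    _ = ∑ j, |a j| * |δ j| := by simp only [abs_mul]
    _ ≤ ∑ j, |a j| * ‖δ‖ := by
        refine Finset.sum_le_sum fun j _ => mul_le_mul_of_nonneg_left ?_ (abs_nonneg _)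
        rw [← Real.norm_eq_abs]; exact norm_le_pi_norm δ j
    _ = (∑ j, |a j|) * ‖δ‖ := by rw [Finset.sum_mul]

/-- **Second-order expansion of a sum of exponentials of linear forms.**  If the weights sum
to zero and the weighted sum of the forms vanishes identically, then
`‖Σ_k w_k e^{i X_k δ} − (−½ Σ_k w_k (X_k δ)²)‖ ≤ C (Σ_j δ_j²) ‖δ‖`,
`C = (Σ_k ‖w_k‖ (Σ_j |a_{kj}|)³) / 6`. -/
theorem birExpand_norm_sub_quad_le (w : κ → ℂ) (a : κ → J → ℝ)
    (hN : ∑ k, w k = 0)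
    (hU : ∀ δ : J → ℝ, ∑ k, w k * ((∑ j, a k j * δ j : ℝ) : ℂ) = 0) (δ : J → ℝ) :
    ‖(∑ k, w k * cexp (I * ((∑ j, a k j * δ j : ℝ) : ℂ)))
        - (-(1 / 2 : ℂ) * ∑ k, w k * ((∑ j, a k j * δ j : ℝ) : ℂ) ^ 2)‖
      ≤ ((∑ k, ‖w k‖ * (∑ j, |a k j|) ^ 3) / 6) * (∑ j, δ j ^ 2) * ‖δ‖ := by
  set X : κ → ℝ := fun k => ∑ j, a k j * δ j with hX
  -- algebra: the difference is the weighted sum of the cubic Taylor remainders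
  have key : (∑ k, w k * cexp (I * (X k : ℂ))) - (-(1 / 2 : ℂ) * ∑ k, w k * (X k : ℂ) ^ 2)
      = ∑ k, w k * (cexp (I * (X k : ℂ)) - 1 - I * (X k : ℂ) + (X k : ℂ) ^ 2 / 2) := by
    have h1 : ∑ k, w k * (cexp (I * (X k : ℂ)) - 1 - I * (X k : ℂ) + (X k : ℂ) ^ 2 / 2)
        = (∑ k, w k * cexp (I * (X k : ℂ))) - (∑ k, w k) - I * (∑ k, w k * (X k : ℂ))
          + (1 / 2 : ℂ) * ∑ k, w k * (X k : ℂ) ^ 2 := by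
      simp only [mul_add, mul_sub, mul_one, Finset.sum_add_distrib, Finset.sum_sub_distrib,
        Finset.mul_sum]
      congr 1
      · congr 1
        refine Finset.sum_congr rfl fun k _ => ?_
        ring
      · refine Finset.sum_congr rfl fun k _ => ?_
        ring
    rw [h1, hN, hU δ]
    ring
  rw [key]
  -- termwise bound
  have hδ2 : ‖δ‖ ^ 2 ≤ ∑ j, δ j ^ 2 := birLaplace_norm_sq_le_sum_sq δ
  calc ‖∑ k, w k * (cexp (I * (X k : ℂ)) - 1 - I * (X k : ℂ) + (X k : ℂ) ^ 2 / 2)‖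
      ≤ ∑ k, ‖w k * (cexp (I * (X k : ℂ)) - 1 - I * (X k : ℂ) + (X k : ℂ) ^ 2 / 2)‖ :=
        norm_sum_le _ _
    _ ≤ ∑ k, ‖w k‖ * ((∑ j, |a k j|) ^ 3 * ((∑ j, δ j ^ 2) * ‖δ‖) / 6) := by
        refine Finset.sum_le_sum fun k _ => ?_
        rw [norm_mul]
        refine mul_le_mul_of_nonneg_left ?_ (norm_nonneg _)
        refine (birExp_norm_taylor_two_le (X k)).trans ?_
        have hXk : |X k| ≤ (∑ j, |a k j|) * ‖δ‖ := birExpand_abs_form_le (a k) δ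
        have hA0 : 0 ≤ ∑ j, |a k j| := Finset.sum_nonneg fun j _ => abs_nonneg _
        have h3 : |X k| ^ 3 ≤ ((∑ j, |a k j|) * ‖δ‖) ^ 3 :=
          pow_le_pow_left₀ (abs_nonneg _) hXk 3
        have h4 : ((∑ j, |a k j|) * ‖δ‖) ^ 3 = (∑ j, |a k j|) ^ 3 * (‖δ‖ ^ 2 * ‖δ‖) := by ring
        have h5 : ‖δ‖ ^ 2 * ‖δ‖ ≤ (∑ j, δ j ^ 2) * ‖δ‖ :=
          mul_le_mul_of_nonneg_right hδ2 (norm_nonneg _)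
        have h6 : (∑ j, |a k j|) ^ 3 * (‖δ‖ ^ 2 * ‖δ‖) ≤ (∑ j, |a k j|) ^ 3 * ((∑ j, δ j ^ 2) * ‖δ‖) :=
          mul_le_mul_of_nonneg_left h5 (pow_nonneg hA0 3)
        linarith
    _ = ((∑ k, ‖w k‖ * (∑ j, |a k j|) ^ 3) / 6) * (∑ j, δ j ^ 2) * ‖δ‖ := by
        have hk : ∀ k, ‖w k‖ * ((∑ j, |a k j|) ^ 3 * ((∑ j, δ j ^ 2) * ‖δ‖) / 6)
            = (‖w k‖ * (∑ j, |a k j|) ^ 3) * (((∑ j, δ j ^ 2) * ‖δ‖) / 6) := fun k => by ring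
        simp_rw [hk]
        rw [← Finset.sum_mul]
        ring

/-- The quadratic germ `−½ Σ_k w_k (X_k δ)²` in matrix form `½ Σ_{ij} Q_{ij} δ_i δ_j` with
`Q_{ij} = −Σ_k w_k a_{ki} a_{kj}`. -/
theorem birExpand_quad_eq_matrix (w : κ → ℂ) (a : κ → J → ℝ) (δ : J → ℝ) :
    -(1 / 2 : ℂ) * ∑ k, w k * ((∑ j, a k j * δ j : ℝ) : ℂ) ^ 2
      = (1 / 2 : ℂ) * ∑ i, ∑ j, (-(∑ k, w k * a k i * a k j)) * δ i * δ j := by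
  have hL : ∀ k, w k * ((∑ j, a k j * δ j : ℝ) : ℂ) ^ 2
      = ∑ i, ∑ j, w k * a k i * a k j * δ i * δ j := by
    intro k
    rw [sq, Complex.ofReal_sum, Finset.sum_mul_sum, Finset.mul_sum]
    refine Finset.sum_congr rfl fun i _ => ?_
    rw [Finset.mul_sum]
    refine Finset.sum_congr rfl fun j _ => ?_
    push_cast
    ring
  have hR : ∀ i j, (-(∑ k, w k * a k i * a k j)) * (δ i : ℂ) * δ j
      = -∑ k, w k * a k i * a k j * δ i * δ j := by
    intro i j
    rw [neg_mul, neg_mul, Finset.sum_mul, Finset.sum_mul]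
  simp_rw [hL, hR]
  have hswap : ∑ k, ∑ i, ∑ j, w k * (a k i : ℂ) * a k j * δ i * δ j
      = ∑ i, ∑ j, ∑ k, w k * (a k i : ℂ) * a k j * δ i * δ j := by
    rw [Finset.sum_comm]
    exact Finset.sum_congr rfl fun i _ => Finset.sum_comm
  rw [hswap]
  simp only [Finset.sum_neg_distrib]
  ring

omit [Fintype J] in
/-- The matrix `Q_{ij} = −Σ_k w_k a_{ki} a_{kj}` is symmetric. -/
theorem birExpand_matrix_isSymm (w : κ → ℂ) (a : κ → J → ℝ) :
    (Matrix.of fun i j : J => -(∑ k, w k * (a k i : ℂ) * a k j)).IsSymm := by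
  refine Matrix.IsSymm.ext fun i j => ?_
  simp only [Matrix.of_apply]
  congr 1
  refine Finset.sum_congr rfl fun k _ => ?_
  ring

end Expand

section Coercive

variable {J : Type*} [Fintype J]

/-- Jordan-type bound: `2y²/π² ≤ 1 − cos y` for `|y| ≤ π`. -/
theorem birCoercive_one_sub_cos {y : ℝ} (hy : |y| ≤ Real.pi) :
    2 / Real.pi ^ 2 * y ^ 2 ≤ 1 - Real.cos y := by
  set t : ℝ := |y| / 2 with ht
  have ht0 : 0 ≤ t := by positivity
  have ht1 : t ≤ Real.pi / 2 := by rw [ht]; linarith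
  have hsin : 2 / Real.pi * t ≤ Real.sin t := Real.mul_le_sin ht0 ht1
  have hcos : 1 - Real.cos y = 2 * Real.sin t ^ 2 := by
    have h1 : Real.cos y = Real.cos |y| := (Real.cos_abs y).symm
    have h2 : Real.sin t ^ 2 = 1 / 2 - Real.cos (2 * t) / 2 := Real.sin_sq_eq_half_sub t
    have h3 : 2 * t = |y| := by rw [ht]; ring
    rw [h3] at h2
    rw [h1, h2]; ring
  have hpos : 0 ≤ 2 / Real.pi * t := by positivity
  have hsq : (2 / Real.pi * t) ^ 2 ≤ Real.sin t ^ 2 := pow_le_pow_left₀ hpos hsin 2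
  have hy2 : y ^ 2 = (2 * t) ^ 2 := by
    rw [ht]; field_simp; rw [sq_abs]
  rw [hcos, hy2]
  have hpi : 0 < Real.pi := Real.pi_pos
  have : 2 / Real.pi ^ 2 * (2 * t) ^ 2 = 2 * (2 / Real.pi * t) ^ 2 := by
    field_simp
  rw [this]
  linarith

omit [Fintype J] in
/-- `Σ_j δ_j² ≤ |J| ‖δ‖²`. -/
theorem birCoercive_sum_sq_le_card_mul [Fintype J] (δ : J → ℝ) :
    ∑ j, δ j ^ 2 ≤ Fintype.card J * ‖δ‖ ^ 2 := by
  calc ∑ j, δ j ^ 2 ≤ ∑ _j : J, ‖δ‖ ^ 2 := by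
        refine Finset.sum_le_sum fun j _ => ?_
        have h := norm_le_pi_norm δ j
        rw [Real.norm_eq_abs] at h
        calc δ j ^ 2 = |δ j| ^ 2 := (sq_abs _).symm
          _ ≤ ‖δ‖ ^ 2 := pow_le_pow_left₀ (abs_nonneg _) h 2
    _ = Fintype.card J * ‖δ‖ ^ 2 := by
        rw [Finset.sum_const, Finset.card_univ, nsmul_eq_mul]

/-- A continuous function, homogeneous of degree two and positive off the origin, dominates a
positive multiple of `Σ_j δ_j²`. -/
theorem birCoercive_quadratic {P : (J → ℝ) → ℝ} (hP : Continuous P)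
    (hhom : ∀ (t : ℝ) (δ : J → ℝ), P (t • δ) = t ^ 2 * P δ)
    (hpos : ∀ δ : J → ℝ, δ ≠ 0 → 0 < P δ) :
    ∃ lam : ℝ, 0 < lam ∧ ∀ δ : J → ℝ, lam * ∑ j, δ j ^ 2 ≤ P δ := by
  by_cases hS : (Metric.sphere (0 : J → ℝ) 1).Nonempty
  · obtain ⟨δ₀, hδ₀S, hmin⟩ :=
      (isCompact_sphere (0 : J → ℝ) 1).exists_isMinOn hS hP.continuousOn
    have hδ₀ : δ₀ ≠ 0 := by
      intro h; rw [h] at hδ₀S; simp at hδ₀S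
    set lam₀ := P δ₀ with hlam₀
    have hlam₀pos : 0 < lam₀ := hpos δ₀ hδ₀
    refine ⟨lam₀ / (Fintype.card J + 1), by positivity, fun δ => ?_⟩
    by_cases hδ : δ = 0
    · subst hδ
      have : P 0 = 0 := by
        have := hhom 0 0
        rw [zero_smul] at this
        linarith
      simp [this]
    · have hn : 0 < ‖δ‖ := norm_pos_iff.2 hδ
      have hunit : ‖δ‖⁻¹ • δ ∈ Metric.sphere (0 : J → ℝ) 1 := by
        rw [mem_sphere_zero_iff_norm, norm_smul, norm_inv, norm_norm, inv_mul_cancel₀ hn.ne']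
      have h1 : lam₀ ≤ P (‖δ‖⁻¹ • δ) := hmin hunit
      have h2 : P δ = ‖δ‖ ^ 2 * P (‖δ‖⁻¹ • δ) := by
        have := hhom ‖δ‖ (‖δ‖⁻¹ • δ)
        rw [smul_smul, mul_inv_cancel₀ hn.ne', one_smul] at this
        exact this
      have h3 : lam₀ * ‖δ‖ ^ 2 ≤ P δ := by rw [h2]; nlinarith
      have h4 := birCoercive_sum_sq_le_card_mul δ
      have hc : (0 : ℝ) ≤ Fintype.card J := Nat.cast_nonneg _
      have h5 : lam₀ / (Fintype.card J + 1) * ∑ j, δ j ^ 2 ≤ lam₀ * ‖δ‖ ^ 2 := by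
        rw [div_mul_eq_mul_div, div_le_iff₀ (by positivity)]
        nlinarith [sq_nonneg ‖δ‖]
      exact h5.trans h3
  · -- no unit vectors: the space is trivial
    refine ⟨1, one_pos, fun δ => ?_⟩
    have hδ : δ = 0 := by
      by_contra h
      have hn : 0 < ‖δ‖ := norm_pos_iff.2 h
      exact hS ⟨‖δ‖⁻¹ • δ, by
        rw [mem_sphere_zero_iff_norm, norm_smul, norm_inv, norm_norm, inv_mul_cancel₀ hn.ne']⟩
    subst hδ
    have : P 0 = 0 := by
      have := hhom 0 0
      rw [zero_smul] at this
      linarith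
    simp [this]

/-- **Local-to-global coercivity on a closed cube.**  A continuous function on
`[-R, R]^J` which vanishes (or is non-positive) only at `0` and dominates `λ Σ δ_j²` on a
neighbourhood `‖δ‖ ≤ ρ` of the origin dominates `m Σ δ_j²` on the whole cube. -/
theorem birCoercive_of_local {P : (J → ℝ) → ℝ} (hP : Continuous P) {R ρ lam : ℝ}
    (hρ : 0 < ρ) (hlam : 0 < lam)
    (hzero : ∀ δ ∈ Set.pi univ (fun _ : J => Icc (-R) R), P δ ≤ 0 → δ = 0)
    (hloc : ∀ δ : J → ℝ, ‖δ‖ ≤ ρ → lam * ∑ j, δ j ^ 2 ≤ P δ) :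
    ∃ m : ℝ, 0 < m ∧ ∀ δ ∈ Set.pi univ (fun _ : J => Icc (-R) R), m * ∑ j, δ j ^ 2 ≤ P δ := by
  set T : Set (J → ℝ) := Set.pi univ (fun _ : J => Icc (-R) R) with hT
  set T' : Set (J → ℝ) := T ∩ {δ | ρ ≤ ‖δ‖} with hT'
  have hTc : IsCompact T := isCompact_univ_pi fun _ => isCompact_Icc
  have hT'c : IsCompact T' :=
    hTc.inter_right (isClosed_le continuous_const continuous_norm)
  -- on the cube, `Σ δ_j² ≤ |J| R²`
  have hsumT : ∀ δ ∈ T, ∑ j, δ j ^ 2 ≤ Fintype.card J * R ^ 2 := by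
    intro δ hδ
    rw [hT, Set.mem_univ_pi] at hδ
    calc ∑ j, δ j ^ 2 ≤ ∑ _j : J, R ^ 2 := by
          refine Finset.sum_le_sum fun j _ => ?_
          have h := hδ j
          rw [mem_Icc] at h
          nlinarith [h.1, h.2]
      _ = Fintype.card J * R ^ 2 := by
          rw [Finset.sum_const, Finset.card_univ, nsmul_eq_mul]
  by_cases hne : T'.Nonempty
  · obtain ⟨δ₁, hδ₁, hmin⟩ := hT'c.exists_isMinOn hne hP.continuousOn
    have hε : 0 < P δ₁ := by
      by_contra h
      push Not at h
      have h0 := hzero δ₁ hδ₁.1 h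
      have : ρ ≤ ‖δ₁‖ := hδ₁.2
      rw [h0, norm_zero] at this
      linarith
    set ε := P δ₁ with hεdef
    refine ⟨min lam (ε / (Fintype.card J * R ^ 2 + 1)), lt_min hlam (by positivity), fun δ hδ => ?_⟩
    by_cases hρδ : ρ ≤ ‖δ‖
    · have hmem : δ ∈ T' := ⟨hδ, hρδ⟩
      have h1 : ε ≤ P δ := hmin hmem
      have h2 := hsumT δ hδ
      have h0 : 0 ≤ ∑ j, δ j ^ 2 := Finset.sum_nonneg fun j _ => sq_nonneg _
      have hpos' : 0 < Fintype.card J * R ^ 2 + 1 := by positivity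
      calc min lam (ε / (Fintype.card J * R ^ 2 + 1)) * ∑ j, δ j ^ 2
          ≤ ε / (Fintype.card J * R ^ 2 + 1) * ∑ j, δ j ^ 2 :=
            mul_le_mul_of_nonneg_right (min_le_right _ _) h0
        _ ≤ ε / (Fintype.card J * R ^ 2 + 1) * (Fintype.card J * R ^ 2 + 1) := by
            refine mul_le_mul_of_nonneg_left (by linarith) ?_
            exact div_nonneg hε.le hpos'.le
        _ = ε := div_mul_cancel₀ _ hpos'.ne'
        _ ≤ P δ := h1
    · push Not at hρδ
      have h0 : 0 ≤ ∑ j, δ j ^ 2 := Finset.sum_nonneg fun j _ => sq_nonneg _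
      calc min lam (ε / (Fintype.card J * R ^ 2 + 1)) * ∑ j, δ j ^ 2
          ≤ lam * ∑ j, δ j ^ 2 := mul_le_mul_of_nonneg_right (min_le_left _ _) h0
        _ ≤ P δ := hloc δ hρδ.le
  · refine ⟨lam, hlam, fun δ hδ => ?_⟩
    have : ‖δ‖ < ρ := by
      by_contra h
      push Not at h
      exact hne ⟨δ, hδ, h⟩
    exact hloc δ this.le

end Coercive

end Summit.HubbardSuperconductivity.HubbardSuperconductivity.Theorems
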